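import Mathlib
import HarnessLib
import HarnessLib.Audit
import Summits.CriticalPhenomena.Statement
import Literature.Probability.RandomPlanarGeometry.HexSAW
import Literature.Probability.RandomPlanarGeometry.LoewnerDescription
import Literature.Probability.RandomPlanarGeometry.LocalMartingale
import Literature.Probability.Process.ItoCalculus
import HarnessLib.Audit.Status.Attr

/-!
Route: SAWTurnDefect

DORMANT since 2026-08-25T12:38:04Z (reconciler: no traction for 7.7 d (last activity item-evidence-added at 2026-08-17T19:14:41Z); parked, not closed — `ledger route dormant route-CriticalPhenomena-SAWTurnDefect --off` to reactivate) — unstaffed, not closed; items shared with open routes are served there. `ledger route dormant <id> --off` reactivates.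

# Route SAWTurnDefect — The polymer's turns against the explorer's — a one-step defect identity
turns the IG identification of the hexagonal SAW into a tip-kernel comparison

It suffices to show X = (KC) ∧ (P) ∧ (R) ∧ (T_H) ∧ (U), realising idea card
turn-defect-kernel-orthogonality ("the self-avoiding walk does not have to walk like the tilted
harmonic explorer — it only has to fool the harmonic measure") on the hexagonal lattice, where the
explorer comparison is native. Objects (all inline over existing declarations): for the critical
hexagonal SAW γ in (Ω_δ; a_δ, b_δ) (`hexSAWLaw`) and a chordal uniformizer φ : ℍ → Ω, the
IMAGINARY-GEOMETRY HARMONIC OBSERVABLE M_t(z) = value at the hexagon z of the discrete harmonic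
extension (simple random walk on hexagon centres = `triGraph`, absorbed on determined hexagons) of
the data: −1 / +1 on boundary hexagons nearest to the φ-images of ℝ₋ / ℝ₊, and, on a hexagon first
flanked by the dart s of γ, (−l if it lies LEFT of that dart, +l if RIGHT) + χ·(W_s − π/2), W_s =
cumulative argument of the φ⁻¹-image of the lattice path at dart s, χ = 2/(3π) (= χ/λ of
Miller–Sheffield at κ = 8/3, λ normalised to 1; the bank constant l is left free because the lattice
renormalises it — conjecturally l_eff = λ′/λ = 2/3).
 (KC) HexFlowLineMartingale — ∃ l such that t ↦ M_t(z), stopped when the tip comes ρ-close to z or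
b, is an L¹-approximate martingale of the SAW filtration, uniformly in the two times and in the
past, as δ → 0. By the route's exact one-step DEFECT IDENTITY (support DefectIdentity: M_(t+1)(z) −
M_t(z) = ω^z_t(v_t)·(f_R − f_L)·(𝟙[γ turns left at t] − p^THE_t) pathwise, v_t the hexagon ahead of
the tip, ω^z_t its harmonic measure from z, p^THE_t the tilted-harmonic-explorer turning
probability) this IS the card's kernel comparison: the harmonic-measure-weighted cumulative
discrepancy between the polymer's turns and the explorer's kernel has vanishing expectation.
 (P) FlowLinePassage — (KC) ⇒ for every subsequential weak limit μ of the hexagonal SAW laws and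
every chordal uniformizer φ through which μ-a.e. curve is Loewner-describable, the time-limited κ =
8/3 imaginary-geometry observable H_t(z) = arg(g_t(z) − W_t) + (1/3)·arg g_t′(z) (W =
drivingFunction φ, g = Loewner.map W, t frozen at (Im z)²/9 — VERBATIM the functional of the sibling
route SAWImaginaryGeometry opened today for card imaginary-geometry-winding-dirichlet; H = (π/2)(1 −
𝔥) for the Miller–Sheffield 𝔥 with λ = 1, coefficient 1/3 = πχ/(2λ)) satisfies the cylinder
(martingale) identities for every z ∈ ℍ.
 (R) HexLimitsDescribable — Kemppainen–Smirnov regularity for the hexagonal SAW; (T_H)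
HexEventualTight and (U) LatticeUniversality (+ HexApproxExists) — the shared hexagonal tightness /
lattice-universality items of routes SAWBetheAnsatz and SAWHexUniversality, imported verbatim.
The card's own decomposition of (KC) — TipPatternEquilibrium (typed crux here), KernelOrthogonality
(ORTH; informal crux filed at open) and TailDecay (layer 2) glued by DefectIdentity — is the
two-layer plan below; IGDrivingMartingales (support, SHARED verbatim with SAWImaginaryGeometry
stmt-CriticalPhenomena-5944: cylinder identities for all z ∈ ℍ ⇒ W/√(8/3) is a continuous local
martingale with quadratic variation t; far-field expansion, 2πχ = (4 − κ)λ) closes the continuum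
side with the tree's `isSLELaw_of_isLocalMartingale_driving_of_lt_four`. Division of labour with the
sibling: SAWImaginaryGeometry files the δℤ² identification chain with its lattice engine
FlowLineMeanValue informal; THIS route files the hexagonal lattice engine in typed form together
with the card's decomposition of it (defect identity, tip-pattern equilibrium, kernel
orthogonality), which is not covered there.
Lean: `HexFlowLineMartingale ∧ FlowLinePassage ∧ HexLimitsDescribable ∧ HexEventualTight ∧
LatticeUniversality` (decls of this route file; each the one-line term of § Cruxes, all elaborated
in the planner's Sketch.lean; route-file imports = the minimal set the statements need: HexSAW,
LoewnerDescription, LocalMartingale, Process.ItoCalculus (cone repair 2026-08-15: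
SLEConvergenceCriterion, SLELawOfDrivingProcessLocal, DrivingFunctionMeasurable are tools of the
assembly PROOF and are imported by the Theorems file that proves Assembly, not here); `lean check`
rc 0)

## Assembly
Standard reductions only (the tail is SAWBetheAnsatz.Assembly, the identification step is
SAWImaginaryGeometry.Assembly transposed to Hex). Fix (D; a, b) and a square-lattice endpoint
approximation; HexApproxExists gives a hexagonal approximation (a′, b′). Hexagonal side: the laws
are probability measures for small δ (`IsEmbEndpointApprox.reachable`, finitely many SAWs in bounded
Ω_δ); HexEventualTight + `isTightAlongMesh_of_isTightMeasureSet_image` +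
`convergesInLawToSLE_of_isTightAlongMesh` (huniq := `IsSLECurve.map_eq_holds`, hY :=
`aemeasurable_embCurve`) reduce `ConvergesInLawToSLE (8/3)` for the hexagonal laws to identifying
every probability weak limit μ along a mesh sequence s_n → 0⁺: pick φ
(`MarkedDomain.exists_isChordalUniformizing_holds`); HexLimitsDescribable gives μ-a.e.
describability; FlowLinePassage fed with HexFlowLineMartingale gives the cylinder identity for W =
drivingFunction φ; null-modify W to W′ := W on the full-measure set of describable curves from a
(a.e. source = a by `IsEmbEndpointApprox.tendsto_fst` + portmanteau), 0 elsewhere (strongly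
measurable marginals `measurable_drivingFunction`, continuous paths, W′_0 = 0
`drivingFunction_apply_zero`); IGDrivingMartingales (Ω := CurveClass ℂ, P := μ) yields the local
martingale + quadratic variation; `isLoewnerDescribed_iff_isDrivenBy` gives μ-a.e.
`Loewner.IsDrivenBy`; `isSLELaw_of_isLocalMartingale_driving_of_lt_four` (0 < 8/3 < 4) gives
`IsSLELaw (8/3) D μ`. LatticeUniversality transfers the test integrals from hexSAWLaw to `SAW.law`
on δℤ², i.e. SAWScalingLimit.

Rationale: WHY THIS LINE. Schramm–Sheffield's harmonic explorer (SchrammSheffield2005, arXiv:math/0310210 p.3)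
is the one lattice curve for which a discrete harmonic function h_t(z) is an EXACT martingale, by
first-step decomposition at the single hexagon revealed per step; the same decomposition, run for an
ARBITRARY law of a hexagonal exploration path with Miller–Sheffield flow-line data
(MillerSheffield2016 Thm 1.1: ∓λ on the boundary arcs, ∓λ′ + χ·winding on the two banks, 2πχ = (4 −
κ)λ), gives the exact identity drift = harmonic measure of the revealed hexagon × data gap × (own
turning probability − tilted-explorer probability). For the x_c-SAW, whose tip kernel is the honest
conditional law of a configurational measure (domain Markov, no kinetic growth), this converts the
imaginary-geometry identification conjecture of the sibling cards
(imaginary-geometry-winding-dirichlet, tilted-harmonic-explorer) into a statement about ONE weighted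
statistic of the difference of two explicit kernels along the walk, and — via Kesten-pattern /
ratio-limit technology at the growing tip (Kesten1963SAW, MadrasSlade1993 §7.4) and boundary-Harnack
localisation of harmonic measure at the tip (Chelkak2016, KennedyLawler2013 local lattice factors) —
into a finite-dimensional orthogonality per pattern radius that exact enumeration can test today.
Imported areas: discrete potential theory / random-walk harmonic measure (probability), GFF–SLE
imaginary geometry (the constants and the continuum martingale, stochastic analysis via the tree's
Lévy/Loewner machinery CDHKSCRAS2014, KemppainenSmirnov2017), ergodic theory of tip patterns
(combinatorics of SAW). What it does that prior routes do not: SAWLaplacianWalk compares the SAW's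
TARGET-switching density with (harmonic measure)^(5/8) (a power law, kernel identification); this
line needs no closed form for the SAW kernel — only that its discrepancy from an affine harmonic
kernel is invisible to harmonic measure — and, next to the sibling route SAWImaginaryGeometry
(opened today for card imaginary-geometry-winding-dirichlet: the δℤ² continuum chain, lattice engine
informal), it is the only route that TYPES a lattice flow-line engine and the only one carrying the
explorer comparison; the negatives index (stmt-0772, all-δ tightness) is avoided by using only
eventual tightness (shared HexEventualTight).

RANKED CRUXES. #2 HexFlowLineMartingale (crux) — (KC) of the card = the dynamic flow-line mean-value
property of the critical hexagonal SAW, in L¹-averaged (cylinder) form: there is a bank constant l ∈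
ℝ such that for every Dobrushin domain, hexagonal endpoint approximation, chordal uniformizer φ,
interior point z₀ with lattice hexagons x_δ → z₀, and ρ, ε > 0, for all small δ: for all k ≤ m and
every event E on the first k steps, |E[(M_(m∧T)(x_δ) − M_(k∧T)(x_δ))·𝟙_E]| ≤ ε, where M_t is the IG
harmonic observable described in § Thesis (SRW sums on `triGraph` with weights 6^(−n), interior =
hexagons all of whose six honeycomb vertices lie in Ω_δ, data frozen at first determination, winding
= cumulative `Complex.arg` of the φ.symm-image darts, χ = 2/(3π)) and T the first step at which the
tip is ρ-close to z₀ or to b. By DefectIdentity the left side telescopes into the expectation of Σ_t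
ω_t(v_t)(f_R,t − f_L,t)(𝟙[left turn] − p^THE_t)·𝟙_E: the kernel comparison. [difficulty:
open-problem] (why it might fail: No exact coupling/identity makes the SAW a lattice flow line: it
holds iff SAW→SLE(8/3) AND harmonically sampled lattice winding converges; frozen-data/zigzag
conventions renormalise l (hence ∃ l), and a convention-induced angle bias of the bank data would
make it false as typed.) [MillerSheffield2016, SchrammSheffield2005, SchrammSheffield2009,
DuplantierBinder2002, LawlerSchrammWerner2004SAW, DuminilCopinSmirnov2012]
#4 TipPatternEquilibrium (crux) — law of large numbers for tip patterns of the chordal critical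
hexagonal SAW: for every radius r there are UNIVERSAL frequencies π_r (independent of the domain and
of the endpoints) such that, for every Dobrushin domain and hexagonal endpoint approximation and
every pattern Q (sublattice class of the tip + the set of darts of the past within triangular-norm
distance r of the tip, in coordinates relative to the tip, each with its winding relative to the
last dart in units of π/3), the proportion of steps t at which the radius-r pattern of γ[0,t] around
γ_t equals Q converges in L¹(hexSAWLaw) to π_r(Q) as δ → 0. The ergodic statement that turns the
localised kernel comparison into one number per pattern radius (card crux TipEquilibrium).
[difficulty: open-problem] (why it might fail: Kesten's pattern theorem gives positive density, not
convergence of frequencies: existence of end-pattern ratio limits is open in d = 2 (MadrasSlade1993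
§7.4, before Thm 7.4.2); the growing tip of the x_c-weighted chordal walk needs a mixing statement
nobody has.) [MadrasSlade1993, Kesten1963SAW, BeatonBousquetMelouDeGierDuminilCopinGuttmann2014,
DuminilCopinSmirnov2012]
#5 FlowLinePassage (crux) — HexFlowLineMartingale ⇒ for every Dobrushin domain, hexagonal endpoint
approximation, mesh sequence s_n → 0⁺ and probability measure μ on CurveClass ℂ that is the weak
limit of the hexagonal SAW curve laws along s_n, and every chordal uniformizer φ with μ-a.e. curve
Loewner-describable through φ: for every z ∈ ℍ the time-limited κ = 8/3 IG observable H_t(z) =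
arg(g_(t∧T_z)(z) − W_(t∧T_z)) + (1/3)·arg g′_(t∧T_z)(z), T_z = (Im z)²/9, W = drivingFunction φ, g =
Loewner.map W (verbatim the functional of SAWImaginaryGeometry.IGMartingaleLimit,
stmt-CriticalPhenomena-5942, so that layer-2 children are shareable), satisfies E_μ[(H_t′(z) −
H_s′(z))·ψ(W_(S_1), …, W_(S_n))] = 0 for s′ ≤ t′, S_k ≤ s′, continuous |ψ| ≤ 1. Content: convergence
of discrete harmonic extensions of ℍ-winding bank data on rough lattice slits to (π/2)(1 − H)
(harmonic measure × winding, prime ends), uniform integrability of the stopped M, identification of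
the effective bank constant l_eff = 2/3 (ρ = 0 force points) from the SAW's exact lattice domain
Markov property, and passage of the L¹-approximate martingale property to the weak limit along
driving processes converging in law. [deps: HexFlowLineMartingale] [difficulty: XL] (why it might
fail: Harmonic measure from z may charge deep lattice fjords/spirals where lattice and continuum
winding differ by O(1) (needs Beurling/Makarov-type control of hm×winding); with l_eff ≠ 2/3 the
limit observable is the SLE_κ(ρ;ρ) flow-line martingale, so ρ = 0 must be extracted from domain
Markov.) [MillerSheffield2016, DuplantierBinder2002, SchrammSheffield2005, KemppainenSmirnov2017,
CDHKSCRAS2014, Chelkak2016]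
#6 HexLimitsDescribable (crux) — Kemppainen–Smirnov regularity for the critical hexagonal SAW: for
every Dobrushin domain, hexagonal endpoint approximation, mesh sequence s_n → 0⁺, probability weak
limit μ of the curve laws (hexSAWLaw pushed to CurveClass ℂ) along s_n and chordal uniformizer φ,
μ-a.e. curve class is Loewner-describable through φ (`IsLoewnerDescribable`) — KS17 Thm 1.5(ii)/Cor
1.7 in output form; the hexagonal twin, same shape, of SAWImaginaryGeometry.SubseqDescribable
(stmt-CriticalPhenomena-5943) and SAWLaplacianWalk.LimitsDescribable (stmt-4481). [difficulty:
open-problem] (why it might fail: Its only engine is Condition G2 (uniform unforced annulus-crossing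
bound over all pasts), for which no SAW technology exists (KS17 §4 covers FK, percolation, harmonic
explorer, LERW only); sub-ballisticity (arXiv:2310.17299) is the strongest known input on Hex.)
[KemppainenSmirnov2017, arXiv:2310.17299, DuminilCopinHammond2013, DuminilCopinSmirnov2012]
#9 DefectIdentity (support) — the exact one-step defect identity behind the route (first-passage
decomposition of SRW sums on the triangular lattice = hexagon centres): for a finite interior set S,
data f, v, z ∈ S and p, f_R ≠ f_L: p·H_(S−v)[f, v↦f_R](z) + (1−p)·H_(S−v)[f, v↦f_L](z) − H_S[f](z) =
ω^z(v)·(f_R − f_L)·(p − (H_S[f](v) − f_L)/(f_R − f_L)), where H_S[g](y) = Σ over `triGraph` walks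
from y staying in S until they exit at u ∉ S of 6^(−length)·g(u) and ω^z(v) = H_(S−v)[𝟙_v](z).
Schramm–Sheffield's martingale lemma is the case p = p^THE; summed along a hexagonal SAW it gives
the pathwise telescoping of § Thesis. Literature-level lemma (next to a future harmonic-explorer
file). [difficulty: provable-now] [SchrammSheffield2005, Lawler1991]
#9 IGDrivingMartingales (support) — continuum extraction, SHARED verbatim with
SAWImaginaryGeometry.IGDrivingMartingales (stmt-CriticalPhenomena-5944): on any probability space, a
real process W with strongly measurable marginals, continuous paths and W_0 = 0 whose time-limited κ
= 8/3 observables H_t(z) = arg(g_t(z) − W_t) + (1/3)·arg g_t′(z) satisfy the cylinder identity at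
every z ∈ ℍ has W/√(8/3) a continuous local martingale with quadratic variation t in its natural
filtration (far field: H_t(z) − arg z = −W_t·Im(1/z) − ½(W_t² − (8/3)t)·Im(1/z²) + O(|z|⁻³); the
coefficient (4−κ)/4 = 1/3 is where κ = 8/3 enters). Consumed with
`isSLELaw_of_isLocalMartingale_driving_of_lt_four` in the Assembly. [difficulty: L] [CDHKSCRAS2014,
MillerSheffield2016,
Literature.Probability.RandomPlanarGeometry.Loewner.isLocalMartingale_hasQuadraticVariation_of_spinCylinderIdentity]
#9 HexEventualTight (support) — eventual tightness of the critical hexagonal SAW curve laws (∃ δ₀,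
the push-forwards for δ ∈ (0, δ₀] form a tight set) — SHARED verbatim with
SAWBetheAnsatz.HexEventualTight (stmt-CriticalPhenomena-4997), where it is a staffed crux; filed
here as support so that this route's staffing keys on its own mechanism. [difficulty: open-problem]
[KemppainenSmirnov2017, arXiv:2310.17299,
Summit.CriticalPhenomena.SAWScalingLimit.Theorems.SAWParafermionTight_refuted]
#9 LatticeUniversality (support) — lattice universality of the chordal critical SAW law (square vs
hexagonal lattice, same Dobrushin domain, test integrals asymptotically equal) — SHARED verbatim
with SAWHexUniversality / SAWBetheAnsatz LatticeUniversality (stmt-CriticalPhenomena-0807, a staffed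
crux there); needed only because the explorer comparison is hexagonal-native while the conjunct is
on δℤ² (alternative, not filed: rerun (KC) on ℤ² with a Schramm–Sheffield ordering rule for the two
undetermined faces). [difficulty: open-problem] [GlazmanManolescu2019, KennedyLawler2013,
DuminilCopinSmirnov2012]
#9 HexApproxExists (support) — every Dobrushin domain admits a hexagonal-lattice endpoint
approximation (IsEmbEndpointApprox hexGraph hexCenter) — SHARED verbatim with
SAWBetheAnsatz.HexApproxExists (stmt-CriticalPhenomena-5001). [difficulty: M]
[DuminilCopinSmirnov2012]

TWO-LAYER PLAN. The card's decomposition of the rank-2 node, to be filed as ONE glued split once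
KernelOrthogonality is typed (definition request HexFlowLineObservable) or once
TipPatternEquilibrium closes: HexFlowLineMartingale ⇐ TipEquilibriumUniform → KernelOrthogonality →
TailDecay → HexFlowLineMartingale, glue = DefectIdentity summed along the walk (pathwise telescoping
M_m − M_k = Σ ω_t(v_t)(f_R − f_L)(𝟙[left] − p^THE_t)) plus the boundary-Harnack factorisation
ω^z_t(v_t) = Ω^z_t·ℓ^(r)_t(1 + o_r(1)). Children: TipEquilibriumUniform = TipPatternEquilibrium
conditionally on the macroscopic past over mesoscopic windows, quantitative enough that (mixing
error) × Σ_t Ω^z_t → 0 (Σ_t Ω_t diverges like δ^(−2/3), so the orthogonality must be exact in the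
limit r → ∞); KernelOrthogonality (informal crux filed at open, rank 3): lim_r limsup_δ of the
Cesàro-averaged LOCALISED defect E[(1/|γ|) Σ_t ℓ^(r)_t (f_R,t − f_L,t)(𝟙[left] − p^(THE,r)_t)] is 0,
i.e. Σ_P π_r(P) ℓ_ω(P) d(P) → 0; TailDecay: the far-field remainders p^THE − p^(THE,r) (Beurling
decay (δ/dist)^(1/2) from a hexagon adjacent to the tip, integrability of harmonically sampled
ℍ-winding) and the factorisation error are o(1) after the ω-weighted summation. FlowLinePassage ⇐
WindingStatistic → UniformIntegrability → FlowLinePassage is the other foreseen split (k = 2).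

KILL CRITERIA. Refutation of HexFlowLineMartingale for EVERY l (e.g. a proof that the ω-weighted
defect has a non-vanishing limit for all bank constants, or numerics (cheapest falsifier) showing no
l in a window around 2/3 − bias works while the unweighted defect vanishes) closes the route
`refuted:HexFlowLineMartingale` and retires the whole imaginary-geometry identification cluster
(cards imaginary-geometry-winding-dirichlet, tilted-harmonic-explorer) with it. Refutation of
TipPatternEquilibrium (non-convergent tip frequencies) kills the localisation only: pivot to (KC)
attacked directly through FlowLineMeanValue-type harmonic estimates, route stays open with cruxes 2,
5, 6. Refutation of FlowLinePassage as typed (e.g. l_eff ≠ 2/3 unpinnable, or winding statistic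
divergent) forces a restatement with the SLE_κ(ρ;ρ) family observable. HexSubseqIdentification
(stmt-4998) proved elsewhere moots cruxes 2–6 (the tail of the assembly then suffices);
LatticeUniversality refuted forces the ℤ²-with-ordering-rule variant of (KC).

NOT DECOMPOSED YET. The constants of the boundary-Harnack localisation and the Beurling tail
(children TailDecay); the quantitative mixing rate in TipEquilibriumUniform; the winding statistic
and uniform integrability inside FlowLinePassage; the identification of l_eff (an (ORTH)-type
exposure-weighted zigzag average, a lattice constant to be FITTED numerically, never fixed in a
statement); contact/fjord hexagons flanked on both sides (absorbed into the frozen-data convention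
and into l, no separate item); the ℤ² variant with an ordering rule; a typed KernelOrthogonality
(waits for the definition request). All are layer-2 material after a crux moves.

CHEAPEST FALSIFIER. Pivot-sample N ≈ 10⁵–10⁶ critical hexagonal SAWs in a lattice half-disc / strip
Dobrushin domain (Kennedy/Clisby pivot + x_c-weighting by length window); along each sample compute
incrementally one sparse Dirichlet solve per step on hexagon centres to get p^THE_t and ω^z_t(v_t)
for a 5×5 grid of far z, with data (∓1; ∓l + (2/(3π))(W − π/2)); estimate the stopped drift E[M_m −
M_k] as a function of l: the route predicts a zero crossing at some l* (near 2/3 minus a lattice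
bias) SIMULTANEOUSLY for all z, k, m and all domains, with the unweighted defect vanishing
identically by symmetry; no common zero ⇒ HexFlowLineMartingale is dead at ~10 CPU-days. Same run,
pattern-resolved at r = 2, 3: the (ORTH) sums and the empirical π_r (stability across domains tests
TipPatternEquilibrium). Control: the tilted harmonic explorer itself (defect ≡ 0) and LERW with κ =
2 constants (χ/λ = 1/π). Not run here (no kit in plancard mode).

NUMBERS. κ = 8/3 ⇔ χ/λ = (4 − κ)/(2π) = 2/(3π) ≈ 0.2122 (λ := 1); λ′/λ = 1 − πχ/(2λ) = 2/3
(conjectured effective bank constant l_eff); data gap at the tip f_R − f_L = 2l + χ(α_L − α_R) ≈ 2l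
+ 2πχ/3 ≈ 2l + 0.444; x_c(Hex) = 1/√(2+√2) (DuminilCopinSmirnov2012 Thm 1); typical harmonic measure
of the hexagon ahead of the tip ≈ δ^(2/3) so Σ_t ω_t ≈ δ^(−2/3) (why ORTH must be exact as r → ∞);
SAW length exponent 4/3 (steps ≈ δ^(−4/3)). Items at open: 10 typed + 1 informal crux.

DEFINITION REQUESTS. (1) HexFlowLineObservable (topic Literature/Probability/RandomPlanarGeometry,
next to HexSAW): the discrete harmonic extension H_S[g] on hexagon centres (SRW on `triGraph`
absorbed off S), the bank/boundary IG data of a hexagonal lattice path w.r.t. a uniformizer (side,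
first-determination dart, cumulative image argument), the observable M_t(z), the hexagon ahead v_t,
its harmonic measure ω^z_t and the tilted-explorer probability p^THE_t — so that
HexFlowLineMartingale/DefectIdentity shrink to one line and KernelOrthogonality can be typed; shared
with cards tilted-harmonic-explorer and imaginary-geometry-winding-dirichlet. (2) HexTipPattern
(same topic): the radius-r relative dart pattern with relative windings used in
TipPatternEquilibrium. No cite/fact requests: the continuum extraction is the shared provable-now
support IGDrivingMartingales and the identification is the tree's
`isSLELaw_of_isLocalMartingale_driving_of_lt_four`.

Novelty: Searches (2026-08-15): `lit search --hybrid "harmonic explorer winding martingale self-avoiding walk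
imaginary geometry flow line lattice"` (10 book hits: Madras–Slade, Lawler 1991/2005, Janse van
Rensburg 2015 — none on a winding-tilted explorer or a kernel comparison); `lit galaxy search
"harmonic explorer" --star all` (23 rows: Lawler's book, Camia–Newman SLE₆, Karrila arXiv:2208.06008
pairing probabilities, theses — no generalised explorer with winding data, no SAW comparison); `lit
vsearch` of the defect identity in prose (10 generic random-walk books); `lit search --hybrid "end
patterns self-avoiding walks …"` + `lit read` MadrasSlade1993 PDF p.197 (§7.4: end-pattern ratio
limits "believed to exist … unproven in 2, 3, or 4 dimensions", Thm 7.4.2 liminf > 0); `lit frontier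
CriticalPhenomena --since 2020` (30 rows; SAW items: arXiv:2310.17299 sub-ballisticity, nothing on
IG/explorer identification); `lit read arXiv:1201.1496` pp.6–8 (constants, sign of the winding term,
−χ arg f′ as harmonic extension of boundary winding); plus the two refuter audits of the card
cluster (arXiv:math/0310210 p.3 read: HE martingale lemma and "the only random path with this
property"; arXiv:0909.5377 §1.1; arXiv:1212.6215 approximate-martingale framework bounds OBSERVABLE
defects, not kernel discrepancies).
Nearest prior art found: SchrammSheffield2005 (arXiv:math/0310210: the p = p^THE case of the defect
identity, κ = 4, constant data); MillerSheffield2016 (arXiv:1201.1496 Thm 1.1: the cont  [refs: 2208.06008, 2310.17299, 1201.1496, math/0310210, 0909.5377, 1212.6215, MadrasSlade1993, SchrammSheffield2005, MillerSheffield2016, KennedyLawler2013]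

Barriers (technique_class: martingale-defect-identity, tip-pattern-equilibrium): - technique_class: martingale-defect-identity, tip-pattern-equilibrium
- Literature.Barriers.CriticalPhenomena.SAWNotKineticallyGrown: respected, not evaded by costume —
the SAW's tip kernel p^SAW_t is the exact conditional law of the configurational x_c-measure (domain
Markov), never a consistent local growth rule; the comparison explorer is NON-local (it reads
harmonic measure of the whole determined region, the HE evasion for κ = 4) and is never claimed to
BE the SAW at finite mesh, only to have a kernel whose discrepancy is harmonically invisible.
- Literature.Barriers.CriticalPhenomena.ParafermionicHalfCauchyRiemann: not triggered — no discrete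
holomorphic observable, no vertex relation; discrete HARMONICITY (a well-posed Dirichlet problem on
every graph) replaces half-holomorphicity; the price is that nothing is exact for the SAW
(HexFlowLineMartingale is asymptotic and averaged).
- Literature.Barriers.CriticalPhenomena.NienhuisWeightsExcludeVertexSAW: not triggered — no exact
local linear relation for a SAW observable is asserted; KernelOrthogonality is an averaged
orthogonality under the tip-pattern equilibrium involving the non-local factor ℓ_ω, outside the
technique class HasExactVertexRelationZ2.
- Literature.Barriers.CriticalPhenomena.EmbeddingModulusUniqueness: evaded as LERW/HE are — the
observable is built from the random walk of the Euclidean embedding (hexagon-centre SRW) and from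
the conformal uniformizer φ, i.e. it is embedding-aware; a sheared lattice chan

History (route lifecycle, newest last):
- 2026-08-25T12:38:04Z · DORMANT — reconciler: no traction for 7.7 d (last activity item-evidence-added at 2026-08-17T19:14:41Z); parked, not closed — `ledger route dormant route-CriticalPhenomen (operator:999:4011228)

sub-problem: SAWScalingLimit · status: dormant · opened planner-plancard-CriticalPhenomena-SAWScaling-a4d97f84-0 2026-08-15T12:19:31Z · rev 2 · ledger route-CriticalPhenomena-SAWTurnDefect
GENERATED by the gate from the ledger (D-0016/17). Provers cite these decls: `theorem foo : Summit.CriticalPhenomena.SAWScalingLimit.Theses.SAWTurnDefect.<Decl> := …` in Summits/CriticalPhenomena/SAWScalingLimit/Theorems/<Name>.lean.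
-/

namespace Summit.CriticalPhenomena.SAWScalingLimit.Theses.SAWTurnDefect

open scoped BigOperators Topology Manifold Classical MeasureTheory ProbabilityTheory Matrix InnerProductSpace ComplexConjugate ContinuousMap
open Filter Set Function TopologicalSpace MeasureTheory

attribute [summit_statement] _root_.SAWScalingLimit

/-- item stmt-CriticalPhenomena-7891 · crux · rank 2 · open · by planner
why it might fail: No exact coupling/identity makes the SAW a lattice flow line: it holds iff SAW→SLE(8/3) AND harmonically sampled lattice winding converges; frozen-data/zigzag conventions renormalise l (hence ∃ l), and a convention-induced angle bias of the bank data would make it false as typed.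
sources: MillerSheffield2016, SchrammSheffield2005, SchrammSheffield2009, DuplantierBinder2002, LawlerSchrammWerner2004SAW, DuminilCopinSmirnov2012
[crux] (KC) of the card = the dynamic flow-line mean-value property of the critical hexagonal SAW,
in L¹-averaged (cylinder) form: there is a bank constant l ∈ ℝ such that for every Dobrushin domain,
hexagonal endpoint approximation, chordal uniformizer φ, interior point z₀ with lattice hexagons x_δ
→ z₀, and ρ, ε > 0, for all small δ: for all k ≤ m and every event E on the first k steps,
|E[(M_(m∧T)(x_δ) − M_(k∧T)(x_δ))·𝟙_E]| ≤ ε, where M_t is the IG harmonic observable described in §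
Thesis (SRW sums on `triGraph` with weights 6^(−n), interior = hexagons all of whose six honeycomb
vertices lie in Ω_δ, data frozen at first determination, winding = cumulative `Complex.arg` of the
φ.symm-image darts, χ = 2/(3π)) and T the first step at which the tip is ρ-close to z₀ or to b. By
DefectIdentity the left side telescopes into the expectation of Σ_t ω_t(v_t)(f_R,t − f_L,t)(𝟙[left
turn] − p^THE_t)·𝟙_E: the kernel comparison. [difficulty: open-problem] -/
@[route_item "route-CriticalPhenomena-SAWTurnDefect", crux]
def HexFlowLineMartingale : Prop :=
  ∃ l : ℝ, ∀ (D : Literature.Probability.RandomPlanarGeometry.DobrushinDomain) (a b : ℝ → Literature.Probability.LatticeModels.HexVertex) (φ : Literature.Probability.RandomPlanarGeometry.ConformalEquiv UpperHalfPlane.upperHalfPlaneSet D.carrier) (z₀ : ℂ) (x : ℝ → Literature.Probability.LatticeModels.Site 2), Literature.Probability.RandomPlanarGeometry.SAW.IsEmbEndpointApprox Literature.Probability.LatticeModels.hexGraph Literature.Probability.LatticeModels.hexCenter D a b → D.IsChordalUniformizing φ → z₀ ∈ D.carrier → Filter.Tendsto (fun δ : ℝ => (δ : ℂ) * Literature.Probability.LatticeModels.triEmbed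 (x δ)) (nhdsWithin 0 (Set.Ioi 0)) (nhds z₀) → ∀ ρ ε : ℝ, 0 < ρ → 0 < ε → ∀ᶠ δ : ℝ in nhdsWithin 0 (Set.Ioi 0), let V := Literature.Probability.LatticeModels.Site 2; let hc := Literature.Probability.LatticeModels.hexCenter; let hf := Literature.Probability.LatticeModels.hexFaceVertices; let Γ : Type := Literature.Probability.RandomPlanarGeometry.SAW.HexDomainSAW D.carrier δ (a δ) (b δ); let H : Set V → (V → ℝ) → V → ℝ := fun S g y => ∑' (u : V), ∑' (w : Literature.Probability.LatticeModels.triGraph.Walk y u), if (∀ q ∈ w.support.dropLast, q ∈ S) ∧ u ∉ S then (1 / 6 : ℝ) ^ w.length * g u else 0; let Hex : Set V := {y | ∀ f : Literature.Probability.LatticeModels.HexVertex, y ∈ hf f → f ∈ Literature.Probability.RandomPlanarGeometry.SAW.embMeshDomain Literature.Probability.LatticeModels.hexGraph hc D.carrier δ}; let pt : Γ → ℕ → Literature.Probability.LatticeModels.HexVertex := fun γ s => γ.walk.getVert s; let Fl : Γ → ℕ → Finset V := fun γ s => hf (pt γ s) ∩ hf (pt γ (s + 1)); let B : Γ → ℕ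 → Set V := fun γ t => {y | ∃ s : ℕ, s < t ∧ s < γ.walk.length ∧ y ∈ Fl γ s}; let s0 : Γ → V → ℕ := fun γ y => sInf {s : ℕ | s < γ.walk.length ∧ y ∈ Fl γ s}; let P : Γ → ℕ → ℂ := fun γ s => φ.symm ((δ : ℂ) * hc (pt γ s)); let W : Γ → ℕ → ℝ := fun γ s => Complex.arg (P γ 1 - P γ 0) + ∑ j ∈ Finset.range s, Complex.arg ((P γ (j + 2) - P γ (j + 1)) / (P γ (j + 1) - P γ j)); let side : Γ → V → ℝ := fun γ y => if 0 < ((starRingEnd ℂ) (hc (pt γ (s0 γ y + 1)) - hc (pt γ (s0 γ y))) * (Literature.Probability.LatticeModels.triEmbed y - hc (pt γ (s0 γ y)))).im then -1 else 1; let arc : Set ℝ → Set ℂ := fun I => φ.boundaryExtension '' {q : ℂ | q.im = 0 ∧ q.re ∈ I}; let dat : Γ → ℕ → V → ℝ := fun γ t y => if y ∈ B γ t then side γ y * l + (2 / (3 * Real.pi)) * (W γ (s0 γ y) - Real.pi / 2) else if Metric.infDist ((δ : ℂ) * Literature.Probability.LatticeModels.triEmbed y) (arc (Set.Iic 0)) ≤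 Metric.infDist ((δ : ℂ) * Literature.Probability.LatticeModels.triEmbed y) (arc (Set.Ici 0)) then -1 else 1; let M : Γ → ℕ → V → ℝ := fun γ t y => H (Hex \ B γ t) (dat γ t) y; let T : Γ → ℕ := fun γ => sInf ({t : ℕ | dist ((δ : ℂ) * hc (pt γ t)) z₀ < ρ ∨ dist ((δ : ℂ) * hc (pt γ t)) (D.pt 1) < ρ} ∪ {γ.walk.length}); ∀ k m : ℕ, k ≤ m → ∀ E : Set (List Literature.Probability.LatticeModels.HexVertex), |∫ γ, (M γ (min m (T γ)) (x δ) - M γ (min k (T γ)) (x δ)) * E.indicator (fun _ => (1 : ℝ)) (γ.walk.support.take (k + 1)) ∂(Literature.Probability.RandomPlanarGeometry.SAW.hexSAWLaw D.carrier δ (a δ) (b δ))| ≤ ε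

/-- item stmt-CriticalPhenomena-7892 · crux · rank 4 · open · by planner
why it might fail: Kesten's pattern theorem gives positive density, not convergence of frequencies: existence of end-pattern ratio limits is open in d = 2 (MadrasSlade1993 §7.4, before Thm 7.4.2); the growing tip of the x_c-weighted chordal walk needs a mixing statement nobody has.
sources: MadrasSlade1993, Kesten1963SAW, BeatonBousquetMelouDeGierDuminilCopinGuttmann2014, DuminilCopinSmirnov2012
[crux] law of large numbers for tip patterns of the chordal critical hexagonal SAW: for every radius
r there are UNIVERSAL frequencies π_r (independent of the domain and of the endpoints) such that,
for every Dobrushin domain and hexagonal endpoint approximation and every pattern Q (sublattice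
class of the tip + the set of darts of the past within triangular-norm distance r of the tip, in
coordinates relative to the tip, each with its winding relative to the last dart in units of π/3),
the proportion of steps t at which the radius-r pattern of γ[0,t] around γ_t equals Q converges in
L¹(hexSAWLaw) to π_r(Q) as δ → 0. The ergodic statement that turns the localised kernel comparison
into one number per pattern radius (card crux TipEquilibrium). [difficulty: open-problem] -/
@[route_item "route-CriticalPhenomena-SAWTurnDefect", crux]
def TipPatternEquilibrium : Prop :=
  ∀ r : ℕ, ∃ π : (Fin 2 × Finset (Literature.Probability.LatticeModels.Site 2 × Fin 2 × Literature.Probability.LatticeModels.Site 2 × Fin 2 × ℤ)) → ℝ, ∀ (D : Literature.Probability.RandomPlanarGeometry.DobrushinDomain) (a b : ℝ → Literature.Probability.LatticeModels.HexVertex), Literature.Probability.RandomPlanarGeometry.SAW.IsEmbEndpointApprox Literature.Probability.LatticeModels.hexGraph Literature.Probability.LatticeModels.hexCenter D a b → ∀ Q : Fin 2 × Finset (Literature.Probability.LatticeModels.Site 2 × Fin 2 × Literature.Probability.LatticeModels.Site 2 × Fin 2 × ℤ), Filter.Tendsto (fun δ : ℝ => ∫ γ, (let pt : ℕ → Literature.Probability.LatticeModels.HexVertex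 := fun s => γ.walk.getVert s; let u : ℕ → ℂ := fun s => Literature.Probability.LatticeModels.hexCenter (pt (s + 1)) - Literature.Probability.LatticeModels.hexCenter (pt s); let turn : ℕ → ℤ := fun j => if 0 < ((starRingEnd ℂ) (u j) * u (j + 1)).im then 1 else -1; let pat : ℕ → Fin 2 × Finset (Literature.Probability.LatticeModels.Site 2 × Fin 2 × Literature.Probability.LatticeModels.Site 2 × Fin 2 × ℤ) := fun t => ((pt t).2, ((Finset.range t).filter (fun s => Literature.Probability.LatticeModels.triNorm ((pt s).1 - (pt t).1) ≤ r ∧ Literature.Probability.LatticeModels.triNorm ((pt (s + 1)).1 - (pt t).1) ≤ r)).image (fun s => ((pt s).1 - (pt t).1, (pt s).2, (pt (s + 1)).1 - (pt t).1, (pt (s + 1)).2, ∑ j ∈ Finset.Ico s (t - 1), turn j))); |((((Finset.range γ.walk.length).filter (fun t => pat t = Q)).card : ℝ) / γ.walk.length) - π Q|) ∂(Literature.Probability.RandomPlanarGeometry.SAW.hexSAWLaw D.carrier δ (a δ) (b δ))) (nhdsWithin 0 (Set.Ioi 0)) (nhds 0)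

/-- item stmt-CriticalPhenomena-7893 · crux · rank 5 · open · by planner
why it might fail: Harmonic measure from z may charge deep lattice fjords/spirals where lattice and continuum winding differ by O(1) (needs Beurling/Makarov-type control of hm×winding); with l_eff ≠ 2/3 the limit observable is the SLE_κ(ρ;ρ) flow-line martingale, so ρ = 0 must be extracted from domain Markov.
sources: MillerSheffield2016, DuplantierBinder2002, SchrammSheffield2005, KemppainenSmirnov2017, CDHKSCRAS2014, Chelkak2016
[crux] HexFlowLineMartingale ⇒ for every Dobrushin domain, hexagonal endpoint approximation, mesh
sequence s_n → 0⁺ and probability measure μ on CurveClass ℂ that is the weak limit of the hexagonal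
SAW curve laws along s_n, and every chordal uniformizer φ with μ-a.e. curve Loewner-describable
through φ: for every z ∈ ℍ the time-limited κ = 8/3 IG observable H_t(z) = arg(g_(t∧T_z)(z) −
W_(t∧T_z)) + (1/3)·arg g′_(t∧T_z)(z), T_z = (Im z)²/9, W = drivingFunction φ, g = Loewner.map W
(verbatim the functional of SAWImaginaryGeometry.IGMartingaleLimit, stmt-CriticalPhenomena-5942, so
that layer-2 children are shareable), satisfies E_μ[(H_t′(z) − H_s′(z))·ψ(W_(S_1), …, W_(S_n))] = 0
for s′ ≤ t′, S_k ≤ s′, continuous |ψ| ≤ 1. Content: convergence of discrete harmonic extensions of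
ℍ-winding bank data on rough lattice slits to (π/2)(1 − H) (harmonic measure × winding, prime ends),
uniform integrability of the stopped M, identification of the effective bank constant l_eff = 2/3 (ρ
= 0 force points) from the SAW's exact lattice domain Markov property, and passage of the
L¹-approximate martingale property to the weak limit along driving processes converging in law.
[deps: HexFlowLineMartingale] -/
@[route_item "route-CriticalPhenomena-SAWTurnDefect", crux]
def FlowLinePassage : Prop :=
  HexFlowLineMartingale → ∀ (D : Literature.Probability.RandomPlanarGeometry.DobrushinDomain) (a b : ℝ → Literature.Probability.LatticeModels.HexVertex), Literature.Probability.RandomPlanarGeometry.SAW.IsEmbEndpointApprox Literature.Probability.LatticeModels.hexGraph Literature.Probability.LatticeModels.hexCenter D a b → ∀ (s : ℕ → ℝ) (μ : MeasureTheory.Measure (Literature.Probability.RandomPlanarGeometry.CurveClass ℂ)), Filter.Tendsto s Filter.atTop (nhdsWithin 0 (Set.Ioi 0)) → MeasureTheory.IsProbabilityMeasure μ → (∀ f : BoundedContinuousFunction (Literature.Probability.RandomPlanarGeometry.CurveClass ℂ) ℝ, Filter.Tendsto (fun n => ∫ γ, f γ.curve ∂(Literature.Probability.RandomPlanarGeometry.SAW.hexSAWLaw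 D.carrier (s n) (a (s n)) (b (s n)))) Filter.atTop (nhds (∫ x, f x ∂μ))) → ∀ φ : Literature.Probability.RandomPlanarGeometry.ConformalEquiv UpperHalfPlane.upperHalfPlaneSet D.carrier, D.IsChordalUniformizing φ → (∀ᵐ c ∂μ, Literature.Probability.RandomPlanarGeometry.IsLoewnerDescribable φ c) → (let H : Literature.Probability.RandomPlanarGeometry.CurveClass ℂ → NNReal → ℂ → ℝ := fun c t z => Complex.arg (Literature.Probability.RandomPlanarGeometry.Loewner.map (Literature.Probability.RandomPlanarGeometry.drivingFunction φ c) (min t (z.im ^ 2 / 9).toNNReal) z - (Literature.Probability.RandomPlanarGeometry.drivingFunction φ c (min t (z.im ^ 2 / 9).toNNReal) : ℂ)) + (1 / 3 : ℝ) * Complex.arg (deriv (Literature.Probability.RandomPlanarGeometry.Loewner.map (Literature.Probability.RandomPlanarGeometry.drivingFunction φ c) (min t (z.im ^ 2 / 9).toNNReal)) z); ∀ z : ℂ, 0 < z.im → ∀ s' t' : NNReal, s' ≤ t' → ∀ (n : ℕ) (S : Fin n → NNReal), (∀ k, S k ≤ s') → ∀ ψ : (Fin n → ℝ) → ℝ,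 Continuous ψ → (∀ v, |ψ v| ≤ 1) → ∫ c, (H c t' z - H c s' z) * ψ (fun k => Literature.Probability.RandomPlanarGeometry.drivingFunction φ c (S k)) ∂μ = 0)

/-- item stmt-CriticalPhenomena-7894 · crux · rank 6 · open · by planner
why it might fail: Its only engine is Condition G2 (uniform unforced annulus-crossing bound over all pasts), for which no SAW technology exists (KS17 §4 covers FK, percolation, harmonic explorer, LERW only); sub-ballisticity (arXiv:2310.17299) is the strongest known input on Hex.
sources: KemppainenSmirnov2017, arXiv:2310.17299, DuminilCopinHammond2013, DuminilCopinSmirnov2012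
[crux] Kemppainen–Smirnov regularity for the critical hexagonal SAW: for every Dobrushin domain,
hexagonal endpoint approximation, mesh sequence s_n → 0⁺, probability weak limit μ of the curve laws
(hexSAWLaw pushed to CurveClass ℂ) along s_n and chordal uniformizer φ, μ-a.e. curve class is
Loewner-describable through φ (`IsLoewnerDescribable`) — KS17 Thm 1.5(ii)/Cor 1.7 in output form;
the hexagonal twin, same shape, of SAWImaginaryGeometry.SubseqDescribable
(stmt-CriticalPhenomena-5943) and SAWLaplacianWalk.LimitsDescribable (stmt-4481). [difficulty:
open-problem] -/
@[route_item "route-CriticalPhenomena-SAWTurnDefect", crux]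
def HexLimitsDescribable : Prop :=
  ∀ (D : Literature.Probability.RandomPlanarGeometry.DobrushinDomain) (a b : ℝ → Literature.Probability.LatticeModels.HexVertex), Literature.Probability.RandomPlanarGeometry.SAW.IsEmbEndpointApprox Literature.Probability.LatticeModels.hexGraph Literature.Probability.LatticeModels.hexCenter D a b → ∀ (s : ℕ → ℝ) (μ : MeasureTheory.Measure (Literature.Probability.RandomPlanarGeometry.CurveClass ℂ)), Filter.Tendsto s Filter.atTop (nhdsWithin 0 (Set.Ioi 0)) → MeasureTheory.IsProbabilityMeasure μ → (∀ f : BoundedContinuousFunction (Literature.Probability.RandomPlanarGeometry.CurveClass ℂ) ℝ, Filter.Tendsto (fun n => ∫ γ, f γ.curve ∂(Literature.Probability.RandomPlanarGeometry.SAW.hexSAWLaw D.carrier (s n) (a (s n)) (b (s n)))) Filter.atTop (nhds (∫ x, f x ∂μ))) → ∀ φ : Literature.Probability.RandomPlanarGeometry.ConformalEquiv UpperHalfPlane.upperHalfPlaneSet D.carrier, D.IsChordalUniformizing φ → ∀ᵐ c ∂μ, Literature.Probability.RandomPlanarGeometry.IsLoewnerDescribable φ c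

-- item stmt-CriticalPhenomena-8295 · support · rank 3 · open · by planner — informal only, no Lean statement yet:
--   [crux] KernelOrthogonality (the card's ORTH, Cesàro-localised form; rank 3, informal until
--   definition HexFlowLineObservable lands). Notation of HexFlowLineMartingale (critical hexagonal SAW γ
--   in (Ω_δ; a_δ, b_δ), uniformizer φ, bank constant l, χ = 2/(3π), bank data ∓l + χ(W − π/2) frozen at
--   the first flanking dart, W = cumulative arg of the φ.symm-image darts). At step t let v_t be the
--   hexagon ahead of the tip (the `triGraph` vertex in hexFaceVertices(γ_t) not flanking dart t−1), L_t
--   = 𝟙[γ turns left at t] (v_t ends on the RIGHT), f_{R,t} = +l + χ(W_t^left − π/2), f_{L,t} = −l +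
--   χ(W_t^right −

/-- item stmt-CriticalPhenomena-0807 · support · rank 9 · open · by planner
sources: GlazmanManolescu2019, KennedyLawler2013, DuminilCopinSmirnov2012
[crux] r2 (hardest, most informative; informal until defn HexSAWLaw lands): lattice universality of
the chordal critical SAW law — for every Dobrushin domain (Ω; a, b), every square-lattice endpoint
approximation (a_δ, b_δ) (Literature.Probability.RandomPlanarGeometry.SAW.IsEndpointApprox) and
every hexagonal-lattice endpoint approximation (a'_δ, b'_δ), and every bounded continuous f on
CurveClass ℂ: ∫ f∘curve dP^{Z^2}_{x_c(Z^2),δ} − ∫ f∘curve dP^{Hex}_{x_c(Hex),δ} → 0 as δ → 0+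
(x_c(Hex) = 1/√(2+√2), Duminil-Copin–Smirnov 2012 Thm 1). Tool: Yang–Baxter track exchange on
rhombic tilings (Glazman–Manolescu arXiv:1708.00395 §3), which so far controls boundary two-point
functions, not curve laws. -/
@[route_item "route-CriticalPhenomena-SAWTurnDefect", crux]
def LatticeUniversality : Prop :=
  ∀ (D : Literature.Probability.RandomPlanarGeometry.DobrushinDomain) (a b : ℝ → Literature.Probability.LatticeModels.Site 2) (a' b' : ℝ → Literature.Probability.LatticeModels.HexVertex), Literature.Probability.RandomPlanarGeometry.SAW.IsEndpointApprox D a b → Literature.Probability.RandomPlanarGeometry.SAW.IsEmbEndpointApprox Literature.Probability.LatticeModels.hexGraph Literature.Probability.LatticeModels.hexCenter D a' b' → ∀ f : BoundedContinuousFunction (Literature.Probability.RandomPlanarGeometry.CurveClass ℂ) ℝ, Filter.Tendsto (fun δ => (∫ γ, f γ.curve ∂(Literature.Probability.RandomPlanarGeometry.SAW.law D.carrier δ (a δ) (b δ))) - ∫ γ, f γ.curve ∂(Literature.Probability.RandomPlanarGeometry.SAW.hexSAWLaw D.carrier δ (a' δ) (b' δ))) (nhdsWithin 0 (Set.Ioi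 0)) (nhds 0)

/-- item stmt-CriticalPhenomena-4997 · support · rank 9 · open · by planner
sources: KemppainenSmirnov2017, arXiv:2310.17299, Summit.CriticalPhenomena.SAWScalingLimit.Theorems.SAWParafermionTight_refuted
[crux] For every Dobrushin domain D and hexagonal endpoint approximation (a_δ, b_δ)
(IsEmbEndpointApprox hexGraph hexCenter) there is δ₀ > 0 such that the push-forwards to CurveClass ℂ
of the critical hexagonal SAW laws hexSAWLaw D δ a_δ b_δ, δ ∈ (0, δ₀], form a tight set of measures.
Intended proof: annulus k-crossing bounds for x_c-SAW on Hex with exponents λ_k → ∞ (from r3's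
rates, even the trivial λ_k ≥ k·λ₁, PLUS an arm-separation/quasi-multiplicativity lemma) fed into
Aizenman–Burchard regularity / Kemppainen–Smirnov Thm 1.5. The ∃δ₀ form avoids the witness that
refuted the all-δ statement stmt-CriticalPhenomena-0772. [deps: CylinderWatermelonGaps] [difficulty:
open-problem] -/
@[route_item "route-CriticalPhenomena-SAWTurnDefect", crux]
def HexEventualTight : Prop :=
  ∀ (D : Literature.Probability.RandomPlanarGeometry.DobrushinDomain) (a b : ℝ → Literature.Probability.LatticeModels.HexVertex), Literature.Probability.RandomPlanarGeometry.SAW.IsEmbEndpointApprox Literature.Probability.LatticeModels.hexGraph Literature.Probability.LatticeModels.hexCenter D a b → ∃ δ₀ : ℝ, 0 < δ₀ ∧ MeasureTheory.IsTightMeasureSet ((fun δ : ℝ => (Literature.Probability.RandomPlanarGeometry.SAW.hexSAWLaw D.carrier δ (a δ) (b δ)).map (fun γ => γ.curve)) '' Set.Ioc 0 δ₀)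

/-- item stmt-CriticalPhenomena-5001 · support · rank 9 · open · by planner
sources: DuminilCopinSmirnov2012
[support] Every Dobrushin domain admits a hexagonal-lattice endpoint approximation: maps a, b : ℝ →
HexVertex with IsEmbEndpointApprox hexGraph hexCenter D a b (points of the largest component Ω_δ ⊆
δℍ joined in Ω_δ for small δ and converging to the two marked prime ends; accessibility of boundary
points of Jordan domains). [difficulty: M] -/
@[route_item "route-CriticalPhenomena-SAWTurnDefect", crux]
def HexApproxExists : Prop :=
  ∀ D : Literature.Probability.RandomPlanarGeometry.DobrushinDomain, ∃ a b : ℝ → Literature.Probability.LatticeModels.HexVertex, Literature.Probability.RandomPlanarGeometry.SAW.IsEmbEndpointApprox Literature.Probability.LatticeModels.hexGraph Literature.Probability.LatticeModels.hexCenter D a b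

/-- item stmt-CriticalPhenomena-5944 · support · rank 9 · open · by planner
sources: CDHKSCRAS2014, MillerSheffield2016, Literature.Probability.RandomPlanarGeometry.Loewner.isLocalMartingale_hasQuadraticVariation_of_spinCylinderIdentity
[support] continuum extraction, provable now on the pattern of
Loewner.isLocalMartingale_hasQuadraticVariation_of_spinCylinderIdentity
(SpinObservableLocalMartingale.lean): on any probability space, a real process W with strongly
measurable marginals, continuous paths and W_0 = 0 whose time-limited κ = 8/3 observables H_t(z) =
arg(g_t(z) − W_t) + (1/3)·arg g_t′(z) satisfy the cylinder identity at every z ∈ ℍ has W/√(8/3) a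
continuous local martingale with ⟨W/√(8/3)⟩_t = t in its natural filtration. Proof sketch: monotone
class ⇒ H_(·∧T_z)(z) are bounded martingales; far field (FarRegime, g_t = z + 2t/z + 2∫W/z² + …):
H_t(z) − arg z = −W_t·Im(1/z) − ½(W_t² − (8/3)t)·Im(1/z²) + O(((M+√t)/|z|)³); z = iy isolates W_t
(the 1/y² term vanishes on the axis), z = y·e^(iπ/4) then isolates W_t² − (8/3)t; localise at
far-field stopping times of fixed levels (moment-free), let y → ∞. [difficulty: L] -/
@[route_item "route-CriticalPhenomena-SAWTurnDefect", crux]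
def IGDrivingMartingales : Prop :=
  ∀ (Ω : Type) [MeasurableSpace Ω] (P : MeasureTheory.Measure Ω) [MeasureTheory.IsProbabilityMeasure P] (W : NNReal → Ω → ℝ) (hW : ∀ t, MeasureTheory.StronglyMeasurable (W t)), (∀ ω, Continuous (W · ω)) → (∀ ω, W 0 ω = 0) → (let H : NNReal → Ω → ℂ → ℝ := fun t ω z => Complex.arg (Literature.Probability.RandomPlanarGeometry.Loewner.map (W · ω) (min t (z.im ^ 2 / 9).toNNReal) z - (W (min t (z.im ^ 2 / 9).toNNReal) ω : ℂ)) + (1 / 3 : ℝ) * Complex.arg (deriv (Literature.Probability.RandomPlanarGeometry.Loewner.map (W · ω) (min t (z.im ^ 2 / 9).toNNReal)) z); ∀ z : ℂ, 0 < z.im → ∀ s t : NNReal, s ≤ t → ∀ (n : ℕ) (S : Fin n → NNReal), (∀ k, S k ≤ s) → ∀ ψ : (Fin n → ℝ) → ℝ, Continuous ψ → (∀ v, |ψ v| ≤ 1) → ∫ ω, (H t ω z - H s ω z) * ψ (fun k => W (S k) ω) ∂P = 0) → Literature.Probability.RandomPlanarGeometry.IsLocalMartingale (fun t ω => (Real.sqrt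 (8 / 3))⁻¹ * W t ω) (MeasureTheory.Filtration.natural W hW) P ∧ Literature.Probability.Process.HasQuadraticVariation (fun t ω => (Real.sqrt (8 / 3))⁻¹ * W t ω) (fun t _ => (t : ℝ)) (MeasureTheory.Filtration.natural W hW) P

/-- item stmt-CriticalPhenomena-7895 · support · rank 9 · open · by planner
sources: SchrammSheffield2005, Lawler1991
[support] the exact one-step defect identity behind the route (first-passage decomposition of SRW
sums on the triangular lattice = hexagon centres): for a finite interior set S, data f, v, z ∈ S and
p, f_R ≠ f_L: p·H_(S−v)[f, v↦f_R](z) + (1−p)·H_(S−v)[f, v↦f_L](z) − H_S[f](z) = ω^z(v)·(f_R −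
f_L)·(p − (H_S[f](v) − f_L)/(f_R − f_L)), where H_S[g](y) = Σ over `triGraph` walks from y staying
in S until they exit at u ∉ S of 6^(−length)·g(u) and ω^z(v) = H_(S−v)[𝟙_v](z). Schramm–Sheffield's
martingale lemma is the case p = p^THE; summed along a hexagonal SAW it gives the pathwise
telescoping of § Thesis. Literature-level lemma (next to a future harmonic-explorer file).
[difficulty: provable-now] -/
@[route_item "route-CriticalPhenomena-SAWTurnDefect", crux]
def DefectIdentity : Prop :=
  ∀ (S : Set (Literature.Probability.LatticeModels.Site 2)) (f : Literature.Probability.LatticeModels.Site 2 → ℝ) (v z : Literature.Probability.LatticeModels.Site 2) (p fR fL : ℝ), let H : Set (Literature.Probability.LatticeModels.Site 2) → (Literature.Probability.LatticeModels.Site 2 → ℝ) → Literature.Probability.LatticeModels.Site 2 → ℝ := fun S' g y => ∑' (u : Literature.Probability.LatticeModels.Site 2), ∑' (w : Literature.Probability.LatticeModels.triGraph.Walk y u), if (∀ q ∈ w.support.dropLast, q ∈ S') ∧ u ∉ S' then (1 / 6 : ℝ) ^ w.length * g u else 0; S.Finite → v ∈ S → z ∈ S → fL ≠ fR → p * H (S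 \ {v}) (Function.update f v fR) z + (1 - p) * H (S \ {v}) (Function.update f v fL) z - H S f z = H (S \ {v}) (Set.indicator {v} 1) z * (fR - fL) * (p - (H S f v - fL) / (fR - fL))

/-- item stmt-CriticalPhenomena-7896 · assembly · rank 1 · open · by planner
sources: KemppainenSmirnov2017, CDHKSCRAS2014, LawlerSchrammWerner2004SAW, DuminilCopinSmirnov2012, Literature.Probability.RandomPlanarGeometry.isSLELaw_of_isLocalMartingale_driving_of_lt_four, Literature.Probability.RandomPlanarGeometry.convergesInLawToSLE_of_isTightAlongMesh
[assembly] HexFlowLineMartingale → FlowLinePassage → IGDrivingMartingales → HexLimitsDescribable →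
HexEventualTight → LatticeUniversality → HexApproxExists → SAWScalingLimit. -/
@[route_item "route-CriticalPhenomena-SAWTurnDefect", crux]
def Assembly : Prop :=
  HexFlowLineMartingale → FlowLinePassage → IGDrivingMartingales → HexLimitsDescribable → HexEventualTight → LatticeUniversality → HexApproxExists → SAWScalingLimit

/-! D-0027 §2.1 — DECIDING THEOREM (planner-authored via `route open/edit --closes-file`; by planner-rbadge-CriticalPhenomena-SAWTurnDefect-885e60ab-g2-0 2026-08-15T16:17:40Z):
its hypotheses are this route's items and its conclusion the sub-problem Statement (glue_lint), and it elaborates with this file. -/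

@[closes "route-CriticalPhenomena-SAWTurnDefect"] theorem closes : HexFlowLineMartingale → TipPatternEquilibrium → FlowLinePassage → HexLimitsDescribable → LatticeUniversality → HexEventualTight → HexApproxExists → IGDrivingMartingales → DefectIdentity → Assembly → _root_.SAWScalingLimit :=
  fun hKC _hTPE hP hD hU hT hA hIG _hDI hAsm => hAsm hKC hP hIG hD hT hU hA

end Summit.CriticalPhenomena.SAWScalingLimit.Theses.SAWTurnDefect
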